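import Summits.QuantumFields.BalabanUV.Beta.EriceFlowEnclosureB12AsPrintedHistoryContagionShiftFlowZeroSemigroupGellMannLowOneLoop
import Mathlib.MeasureTheory.Integral.IntervalIntegral.AbsolutelyContinuousFun

/-!
# Beta / EriceFlowEnclosureB12AsPrintedHistoryContagionShiftFlowZeroSemigroupGellMannLowIntegral — ASYMPTOTIC FREEDOM IS CONTAGIOUS, part 59: RENORMALIZATION-GROUP TIME IS
# THE INTEGRAL OF THE INVERSE GENERATOR — `s = ∫ dg∕|β_c(g)|` for the flow with memory, with β_c the ALMOST-EVERYWHERE generator of parts 55–57 and NO differentiability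
# hypothesis on the functional; and the INTEGRATED ONE-LOOP LAW with the sharp defect `2κ(1∕φ_s g − 1∕g)`.  The Λ-coordinate is only known to be differentiable almost
# everywhere (part 55) — too little for the naive fundamental theorem of calculus —, but part 35's chart bounds make it LOCALLY LIPSCHITZ on ]0, e′]
# (`abel_lipschitzOnWith`), hence ABSOLUTELY CONTINUOUS on every compact subinterval (`abel_absolutelyContinuousOnInterval`), and Lebesgue's fundamental theorem for
# absolutely continuous functions (Mathlib's `AbsolutelyContinuousOnInterval.integral_deriv_eq_sub`) gives (§94, ABSTRACT) **`∫_{g₁}^{g₂} Λ′ = Λ g₂ − Λ g₁`**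
# (`abel_integral_deriv`) and THE TEXTBOOK FORMULA FOR RG TIME: **`s = ∫_{φ_s g}^{g} (−Λ′(x)∕β₀) dx = ∫_{φ_s g}^{g} dx∕|β_c(x)|`** (**`rg_time_eq_integral`**, `β_c = β₀∕Λ′` the
# a.e. velocity field of part 56 — the scale elapsed is the integral of the inverse generator over the couplings traversed).  (§95, FOR THE FLOW: `B` with memory profile,
# ONE AF reference, part 14's package at e′, Λ any dynamical Abel function) part 57's a.e. bound `−Λ′(x) = (2∕x³)(1 ± κx)` integrates to
# **`|(Λ g₁ − Λ g₂) − (1∕g₁² − 1∕g₂²)| ≤ 2κ(1∕g₁ − 1∕g₂)`** (**`abs_dynAbel_sub_sub_chart_le_sharp`**) — SHARPER than part 44's `κg₂(1∕g₁² − 1∕g₂²) = κ(1∕g₁ − 1∕g₂)(g₂∕g₁ + 1)`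
# by the factor `2∕(g₂∕g₁ + 1)`, which tends to 0 deep in the ultraviolet — and hence THE INTEGRATED ONE-LOOP LAW OF THE CONTINUOUS RG WITH SQUARE-ROOT DEFECT AND NO ADDITIVE
# CONSTANT: **`|1∕φ_s(g)² − 1∕g² − sβ₀| ≤ 2κ(1∕φ_s g − 1∕g)`** for every `g ∈ ]0, e′]`, `s ≥ 0` (**`abs_rg_chart_sub_le_sharp`**; part 47 had `κg(1∕φ_s(g)² − 1∕g²)`,
# part 51's `L∕φ_s(g) + M` carried an additive constant).
# (β-flow team, prover 1 = recursion ∕ upper ∕ bare-coupling ∕ uniqueness side, unit `b2b-balaban-beta-bflow-p1`, gen 41; ROW AP-I·Uc × NODE U2 — the infinitesimal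
# renormalization group, integrated; over part 57 `…GellMannLowOneLoop` (`ae_hasDerivAt_dynAbel_oneLoop`), part 46 (`rg_mem_eq`, `rg_le_self`), Mathlib's
# `LipschitzOnWith.absolutelyContinuousOnInterval`, `AbsolutelyContinuousOnInterval.integral_deriv_eq_sub`, `intervalIntegral.integral_mono_ae_restrict`)

HONEST FRAMING (page 1 of everything the β sub-cell writes): discharging `BetaPertH` makes Bałaban's UV stability UNCONDITIONAL — a
real constructive-QFT result; it is NOT the continuum limit and NOT the Clay problem.  HONEST DEPENDENCY (cell reorg 2026-08-19,
verbatim): «continuum YM on T⁴ ⇐ BetaPertH ∧ nine spine estimates (0/9 proved); BetaPertH ⇐ (D1) ∧ (D4) ∧ CAP+tail; G-an2-4 gates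
asym, D1 and NE2/3/4.»  THIS MODULE DISCHARGES NOTHING: [folklore] real analysis (Lebesgue's fundamental theorem of calculus for absolutely continuous functions,
monotonicity of the integral under an a.e. bound, one explicit primitive) over node U2's HYPOTHESIS SHAPES `T4BetaStationary.{SeqBox, MemoryProfile}`,
`T4BetaFlowWellPosed.{MemFlow, solution}` on an ABSTRACT functional `B`; parts 46 ∕ 54 ∕ 57 BY NAME — nothing restated.  [I] THEOREM 2 (p. 259, STATED WITHOUT PROOF)
does not occur in this abstract part; NOTHING is asserted about Bałaban's actual β; «RG time», «generator», «β_c» are OUR READING (the formula `t = ∫ dg∕β(g)` of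
perturbative renormalization is the analogue; nothing of it is imported or claimed).  [I] = T. Bałaban, Commun. Math. Phys. **109** (1987) 249–301 [Balaban1987RG1].

WHAT THIS FILE PROVES (0 sorry, 0 def): §94 **`abel_lipschitzOnWith`**, `abel_absolutelyContinuousOnInterval`, **`abel_integral_deriv`**, **`rg_time_eq_integral`**;
§95 `integral_chart_bounds`, **`abs_dynAbel_sub_sub_chart_le_sharp`**, **`abs_rg_chart_sub_le_sharp`**.  NOT CLAIMED: anything about Bałaban's β; `BetaPertH`;
continuum; Clay.
-/

namespace Summit.QuantumFields.BalabanUV.Beta.EriceFlowEnclosureB12AsPrintedHistoryContagionShiftFlowZeroSemigroupGellMannLowIntegral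

open Filter Topology Set Function MeasureTheory intervalIntegral
open Literature.MathematicalPhysics.QuantumFieldTheory.Balaban1983to89
open Literature.MathematicalPhysics.QuantumFieldTheory.Balaban1983to89.T4BetaStationary (SeqBox MemoryProfile)
open Literature.MathematicalPhysics.QuantumFieldTheory.Balaban1983to89.T4BetaFlowWellPosed (MemFlow solution)
open Summit.QuantumFields.BalabanUV.Beta.EriceFlowEnclosureB12AsPrintedHistoryContagionShiftFlowZeroSemigroup (rg_mem_eq rg_le_self)
open Summit.QuantumFields.BalabanUV.Beta.EriceFlowEnclosureB12AsPrintedHistoryContagionShiftFlowZeroSemigroupGellMannLowOneLoop (dynAbel_chart_bounds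
  ae_hasDerivAt_dynAbel_oneLoop)

noncomputable section

/-! ## §94 The Λ-coordinate is locally Lipschitz, hence absolutely continuous: RG time is an integral (abstract) -/

variable {Λ : ℝ → ℝ} {e' β₀ : ℝ}

/-- **THE Λ-COORDINATE IS LIPSCHITZ ON EVERY COMPACT SUBINTERVAL** `[g₁, g₂] ⊆ ]0, e′]`: `|Λ x − Λ y| ≤ (4∕3)|1∕x² − 1∕y²| ≤ (8g₂∕(3g₁⁴))·|x − y|` from part 35's chart
bounds. [folklore] -/
theorem abel_lipschitzOnWith (hbounds : ∀ e₁ ∈ Ioc (0 : ℝ) e', ∀ e₂ ∈ Ioc (0 : ℝ) e', e₁ ≤ e₂ →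
      2 / 3 * (1 / e₁ ^ 2 - 1 / e₂ ^ 2) ≤ Λ e₁ - Λ e₂ ∧ Λ e₁ - Λ e₂ ≤ 4 / 3 * (1 / e₁ ^ 2 - 1 / e₂ ^ 2))
    {g₁ g₂ : ℝ} (hg₁ : g₁ ∈ Ioc (0 : ℝ) e') (hg₂ : g₂ ∈ Ioc (0 : ℝ) e') (h12 : g₁ ≤ g₂) :
    LipschitzOnWith (Real.toNNReal (8 * g₂ / (3 * g₁ ^ 4))) Λ (uIcc g₁ g₂) := by
  refine LipschitzOnWith.of_dist_le' fun x hx y hy => ?_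
  rw [uIcc_of_le h12] at hx hy
  have hx0 : 0 < x := hg₁.1.trans_le hx.1
  have hy0 : 0 < y := hg₁.1.trans_le hy.1
  have hxmem : x ∈ Ioc (0 : ℝ) e' := ⟨hx0, hx.2.trans hg₂.2⟩
  have hymem : y ∈ Ioc (0 : ℝ) e' := ⟨hy0, hy.2.trans hg₂.2⟩
  rw [Real.dist_eq, Real.dist_eq]
  -- `|Λ x − Λ y| ≤ (4∕3)|1∕x² − 1∕y²|`
  have hchart : |Λ x - Λ y| ≤ 4 / 3 * |1 / x ^ 2 - 1 / y ^ 2| := by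
    rcases le_total x y with hxy | hyx
    · obtain ⟨h1, h2⟩ := hbounds x hxmem y hymem hxy
      have hnn : 0 ≤ 1 / x ^ 2 - 1 / y ^ 2 := by nlinarith
      rw [abs_of_nonneg (by linarith), abs_of_nonneg hnn]; exact h2
    · obtain ⟨h1, h2⟩ := hbounds y hymem x hxmem hyx
      have hnn : 0 ≤ 1 / y ^ 2 - 1 / x ^ 2 := by nlinarith
      rw [abs_sub_comm, abs_of_nonneg (by linarith), abs_sub_comm, abs_of_nonneg hnn]; exact h2
  -- `|1∕x² − 1∕y²| = |x − y|(x + y)∕(x²y²) ≤ (2g₂∕g₁⁴)|x − y|`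
  have hfac : |1 / x ^ 2 - 1 / y ^ 2| = |x - y| * ((x + y) / (x ^ 2 * y ^ 2)) := by
    rw [show 1 / x ^ 2 - 1 / y ^ 2 = (y - x) * ((x + y) / (x ^ 2 * y ^ 2)) by field_simp; ring, abs_mul, abs_sub_comm,
      abs_of_pos (by positivity : 0 < (x + y) / (x ^ 2 * y ^ 2))]
  have hratio : (x + y) / (x ^ 2 * y ^ 2) ≤ 2 * g₂ / g₁ ^ 4 := by
    rw [div_le_div_iff₀ (by positivity) (by have := hg₁.1; positivity)]
    have h1 : x + y ≤ 2 * g₂ := by linarith [hx.2, hy.2]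
    have hg0 := hg₁.1
    have h2 : g₁ ^ 2 ≤ x ^ 2 := by nlinarith [hx.1]
    have h3 : g₁ ^ 2 ≤ y ^ 2 := by nlinarith [hy.1]
    have h4 : g₁ ^ 4 ≤ x ^ 2 * y ^ 2 := by
      calc g₁ ^ 4 = g₁ ^ 2 * g₁ ^ 2 := by ring
        _ ≤ x ^ 2 * y ^ 2 := mul_le_mul h2 h3 (by positivity) (by positivity)
    calc (x + y) * g₁ ^ 4 ≤ 2 * g₂ * (x ^ 2 * y ^ 2) := mul_le_mul h1 h4 (by positivity) (by linarith [hg₂.1])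
      _ = 2 * g₂ * (x ^ 2 * y ^ 2) := rfl
  calc |Λ x - Λ y| ≤ 4 / 3 * |1 / x ^ 2 - 1 / y ^ 2| := hchart
    _ = 4 / 3 * (|x - y| * ((x + y) / (x ^ 2 * y ^ 2))) := by rw [hfac]
    _ ≤ 4 / 3 * (|x - y| * (2 * g₂ / g₁ ^ 4)) := by
        refine mul_le_mul_of_nonneg_left (mul_le_mul_of_nonneg_left hratio (abs_nonneg _)) (by norm_num)
    _ = 8 * g₂ / (3 * g₁ ^ 4) * |x - y| := by ring

/-- **… HENCE ABSOLUTELY CONTINUOUS** on `[g₁, g₂]`. [folklore] -/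
theorem abel_absolutelyContinuousOnInterval (hbounds : ∀ e₁ ∈ Ioc (0 : ℝ) e', ∀ e₂ ∈ Ioc (0 : ℝ) e', e₁ ≤ e₂ →
      2 / 3 * (1 / e₁ ^ 2 - 1 / e₂ ^ 2) ≤ Λ e₁ - Λ e₂ ∧ Λ e₁ - Λ e₂ ≤ 4 / 3 * (1 / e₁ ^ 2 - 1 / e₂ ^ 2))
    {g₁ g₂ : ℝ} (hg₁ : g₁ ∈ Ioc (0 : ℝ) e') (hg₂ : g₂ ∈ Ioc (0 : ℝ) e') (h12 : g₁ ≤ g₂) :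
    AbsolutelyContinuousOnInterval Λ g₁ g₂ :=
  (abel_lipschitzOnWith hbounds hg₁ hg₂ h12).absolutelyContinuousOnInterval

/-- **LEBESGUE'S FUNDAMENTAL THEOREM FOR THE Λ-COORDINATE**: `∫_{g₁}^{g₂} Λ′ = Λ g₂ − Λ g₁` on every `[g₁, g₂] ⊆ ]0, e′]` — with `Λ′ = deriv Λ` the ALMOST-EVERYWHERE
derivative of part 55 (no differentiability hypothesis: Λ is absolutely continuous). [folklore] -/
theorem abel_integral_deriv (hbounds : ∀ e₁ ∈ Ioc (0 : ℝ) e', ∀ e₂ ∈ Ioc (0 : ℝ) e', e₁ ≤ e₂ →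
      2 / 3 * (1 / e₁ ^ 2 - 1 / e₂ ^ 2) ≤ Λ e₁ - Λ e₂ ∧ Λ e₁ - Λ e₂ ≤ 4 / 3 * (1 / e₁ ^ 2 - 1 / e₂ ^ 2))
    {g₁ g₂ : ℝ} (hg₁ : g₁ ∈ Ioc (0 : ℝ) e') (hg₂ : g₂ ∈ Ioc (0 : ℝ) e') (h12 : g₁ ≤ g₂) :
    ∫ x in g₁..g₂, deriv Λ x = Λ g₂ - Λ g₁ :=
  (abel_absolutelyContinuousOnInterval hbounds hg₁ hg₂ h12).integral_deriv_eq_sub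

/-- **RENORMALIZATION-GROUP TIME IS THE INTEGRAL OF THE INVERSE GENERATOR**: Λ strictly antitone on ]0, e′] onto `[Λ e′, ∞[` with the chart bounds (2∕3, 4∕3),
β₀ > 0; then for every `g ∈ ]0, e′]` and `s ≥ 0`: **`s = ∫_{φ_s g}^{g} (−Λ′(x)∕β₀) dx`** — with part 56's a.e. velocity field `β_c = β₀∕Λ′ < 0` this reads
`s = ∫_{φ_s g}^{g} dx∕|β_c(x)|`: the scale elapsed equals the integral of the inverse generator over the couplings traversed, for the flow with memory, without any
differentiability hypothesis. [folklore] -/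
theorem rg_time_eq_integral (hanti : StrictAntiOn Λ (Ioc 0 e')) (honto : ∀ y : ℝ, Λ e' ≤ y → ∃ x ∈ Ioc (0 : ℝ) e', Λ x = y) (hβ₀ : 0 < β₀)
    (hbounds : ∀ e₁ ∈ Ioc (0 : ℝ) e', ∀ e₂ ∈ Ioc (0 : ℝ) e', e₁ ≤ e₂ →
      2 / 3 * (1 / e₁ ^ 2 - 1 / e₂ ^ 2) ≤ Λ e₁ - Λ e₂ ∧ Λ e₁ - Λ e₂ ≤ 4 / 3 * (1 / e₁ ^ 2 - 1 / e₂ ^ 2))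
    {g s : ℝ} (hg : g ∈ Ioc (0 : ℝ) e') (hs : 0 ≤ s) :
    s = ∫ x in invFunOn Λ (Ioc 0 e') (Λ g + s * β₀)..g, -deriv Λ x / β₀ := by
  obtain ⟨hxmem, hΛx⟩ := rg_mem_eq hanti honto hβ₀.le hg hs
  have hle : invFunOn Λ (Ioc 0 e') (Λ g + s * β₀) ≤ g := rg_le_self hanti honto hβ₀.le hg hs
  rw [intervalIntegral.integral_div, intervalIntegral.integral_neg, abel_integral_deriv hbounds hxmem hg hle, hΛx]
  field_simp
  ring

/-! ## §95 For the flow: the integrated one-loop law from the almost-everywhere generator, with the sharp defect -/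

/-- The explicit primitive: `∫_{g₁}^{g₂} (2∕x³ + c∕x²) dx = (1∕g₁² − 1∕g₂²) + c(1∕g₁ − 1∕g₂)` for `0 < g₁ ≤ g₂`. [folklore] -/
theorem integral_chart_bounds {g₁ g₂ c : ℝ} (hg₁ : 0 < g₁) (h12 : g₁ ≤ g₂) :
    ∫ x in g₁..g₂, (2 / x ^ 3 + c / x ^ 2) = (1 / g₁ ^ 2 - 1 / g₂ ^ 2) + c * (1 / g₁ - 1 / g₂) := by
  have hpos : ∀ x ∈ uIcc g₁ g₂, 0 < x := fun x hx => by rw [uIcc_of_le h12] at hx; exact hg₁.trans_le hx.1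
  have hderiv : ∀ x ∈ uIcc g₁ g₂, HasDerivAt (fun x : ℝ => -(1 / x ^ 2) - c / x) (2 / x ^ 3 + c / x ^ 2) x := by
    intro x hx
    have hx0 : x ≠ 0 := (hpos x hx).ne'
    have h1 : HasDerivAt (fun x : ℝ => 1 / x ^ 2) (-(↑(2 : ℕ) * x ^ (2 - 1)) / (x ^ 2) ^ 2) x :=
      ((hasDerivAt_pow 2 x).inv (pow_ne_zero 2 hx0)).congr_of_eventuallyEq (Eventually.of_forall fun y => by simp [one_div])
    have h2 : HasDerivAt (fun x : ℝ => c / x) (-c / x ^ 2) x := by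
      have := (hasDerivAt_const x c).div (hasDerivAt_id x) hx0
      refine this.congr_deriv ?_
      simp only [id_eq]
      ring
    refine (h1.neg.sub h2).congr_deriv ?_
    push_cast
    field_simp
    ring
  have hcont : ContinuousOn (fun x : ℝ => 2 / x ^ 3 + c / x ^ 2) (uIcc g₁ g₂) := by
    refine ContinuousOn.add ?_ ?_
    · exact continuousOn_const.div (continuousOn_pow 3) fun x hx => pow_ne_zero 3 (hpos x hx).ne'
    · exact continuousOn_const.div (continuousOn_pow 2) fun x hx => pow_ne_zero 2 (hpos x hx).ne'
  rw [intervalIntegral.integral_eq_sub_of_hasDerivAt hderiv (hcont.intervalIntegrable)]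
  have hg₂ : g₂ ≠ 0 := (hg₁.trans_le h12).ne'
  field_simp
  ring

/-- **THE INTEGRATED ISOMETRY, SHARP**: for every dynamical Abel function Λ of the flow near the zero pin (strictly antitone on ]0, e′]) and `0 < g₁ ≤ g₂ ≤ e′`:
**`|(Λ g₁ − Λ g₂) − (1∕g₁² − 1∕g₂²)| ≤ 2κ(1∕g₁ − 1∕g₂)`**, `κ = 64C_m∕(3(1−θ)β*)` — part 57's a.e. bound `−Λ′(x) = (2∕x³)(1 ± κx)` integrated by Lebesgue's FTC.  Part 44's
bound was `κg₂(1∕g₁² − 1∕g₂²) = κ(1∕g₁ − 1∕g₂)(g₂∕g₁ + 1) ≥ 2κ(1∕g₁ − 1∕g₂)`: the infinitesimal route is sharper by the factor `2∕(g₂∕g₁ + 1) → 0` deep in the ultraviolet.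
[cite: Balaban1987RG1, Thm 2 (0.31) p.259 with (0.18)–(0.20) pp.255–256] -/
theorem abs_dynAbel_sub_sub_chart_le_sharp {B : (ℕ → ℝ) → ℝ} {Cm θ γ bs ta gs e' : ℝ} {t : ℕ → ℝ} {a : ℕ → ℝ} {Λ : ℝ → ℝ}
    (hB : MemoryProfile Cm θ γ B) (hCm : 0 ≤ Cm) (hθ0 : 0 ≤ θ) (hθ1 : θ < 1) (hbs : 0 < bs) (hta : 0 < ta)
    (hts : SeqBox γ t) (htf : MemFlow B gs t) (hprof : ∀ m : ℕ, 1 / ta ^ 2 + bs * (m : ℝ) ≤ 1 / (t m) ^ 2)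
    (hΛ : ∀ e ∈ Ioc (0 : ℝ) e', ∀ h : ℕ → ℝ, SeqBox γ h → MemFlow B e h → Tendsto (fun n => 1 / h n ^ 2 - a n) atTop (𝓝 (Λ e)))
    (hanti : StrictAntiOn Λ (Ioc 0 e'))
    (h2e' : 2 * e' ≤ γ)
    (hs1 : 4 * Cm * e' ≤ bs * (1 - θ))
    (hs2 : e' ^ 2 * (1 / gs ^ 2 + Cm * γ / (1 - θ) ^ 2 + (2 * Cm / ((1 - θ) * bs)) ^ 2) ≤ 3 / 4)
    (hs4 : 64 * Cm * e' ^ 3 ≤ (1 - θ) ^ 2) (hs5 : Cm * (8 * e' ^ 3 + 16 * e' / bs) ≤ (1 - θ) / 4)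
    {g₁ g₂ : ℝ} (hg₁ : g₁ ∈ Ioc (0 : ℝ) e') (hg₂ : g₂ ∈ Ioc (0 : ℝ) e') (h12 : g₁ ≤ g₂) :
    |(Λ g₁ - Λ g₂) - (1 / g₁ ^ 2 - 1 / g₂ ^ 2)| ≤ 2 * (64 * Cm / (3 * (1 - θ) * bs)) * (1 / g₁ - 1 / g₂) := by
  set κ := 64 * Cm / (3 * (1 - θ) * bs) with hκdef
  have hbounds := dynAbel_chart_bounds hB hCm hθ0 hθ1 hbs hta hts htf hprof hΛ h2e' hs1 hs2 hs4 hs5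
  have hac := abel_absolutelyContinuousOnInterval hbounds hg₁ hg₂ h12
  have hftc : ∫ x in g₁..g₂, deriv Λ x = Λ g₂ - Λ g₁ := hac.integral_deriv_eq_sub
  have hint : IntervalIntegrable (deriv Λ) volume g₁ g₂ := hac.intervalIntegrable_deriv
  -- a.e. on [g₁, g₂]: `(2∕x³)(1 − κx) ≤ −Λ′ x ≤ (2∕x³)(1 + κx)`
  have hae := ae_hasDerivAt_dynAbel_oneLoop hB hCm hθ0 hθ1 hbs hta hts htf hprof hΛ hanti h2e' hs1 hs2 hs4 hs5
  have hne : ∀ᵐ x ∂volume, x ∉ ({e'} : Set ℝ) := measure_eq_zero_iff_ae_notMem.1 Real.volume_singleton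
  have hpos : ∀ x ∈ uIcc g₁ g₂, 0 < x := fun x hx => by rw [uIcc_of_le h12] at hx; exact hg₁.1.trans_le hx.1
  have hlo : ∀ᵐ x ∂volume.restrict (Icc g₁ g₂), (2 / x ^ 3 + (-2 * κ) / x ^ 2) ≤ -deriv Λ x := by
    rw [ae_restrict_iff' measurableSet_Icc]
    filter_upwards [hae, hne] with x hx hxne hxI
    have hxo : x ∈ Ioo (0 : ℝ) e' := ⟨hg₁.1.trans_le hxI.1, lt_of_le_of_ne (hxI.2.trans hg₂.2) hxne⟩
    obtain ⟨D, hD, hb⟩ := hx hxo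
    rw [hD.deriv]
    obtain ⟨h1, h2⟩ := abs_le.1 hb
    have hx3 : 0 < x ^ 3 := pow_pos hxo.1 3
    -- `(−x³∕2)D ≥ 1 − κx` ⟹ `−D ≥ (2∕x³)(1 − κx) = 2∕x³ − 2κ∕x²`
    have key : -D * x ^ 3 ≥ 2 * (1 - κ * x) := by nlinarith
    have : 2 / x ^ 3 + (-2 * κ) / x ^ 2 = 2 * (1 - κ * x) / x ^ 3 := by
      rw [div_add_div _ _ (pow_ne_zero 3 hxo.1.ne') (pow_ne_zero 2 hxo.1.ne'),
        div_eq_div_iff (mul_ne_zero (pow_ne_zero 3 hxo.1.ne') (pow_ne_zero 2 hxo.1.ne')) (pow_ne_zero 3 hxo.1.ne')]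
      ring
    rw [this, div_le_iff₀ hx3]
    linarith
  have hhi : ∀ᵐ x ∂volume.restrict (Icc g₁ g₂), -deriv Λ x ≤ (2 / x ^ 3 + (2 * κ) / x ^ 2) := by
    rw [ae_restrict_iff' measurableSet_Icc]
    filter_upwards [hae, hne] with x hx hxne hxI
    have hxo : x ∈ Ioo (0 : ℝ) e' := ⟨hg₁.1.trans_le hxI.1, lt_of_le_of_ne (hxI.2.trans hg₂.2) hxne⟩
    obtain ⟨D, hD, hb⟩ := hx hxo
    rw [hD.deriv]
    obtain ⟨h1, h2⟩ := abs_le.1 hb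
    have hx3 : 0 < x ^ 3 := pow_pos hxo.1 3
    have key : -D * x ^ 3 ≤ 2 * (1 + κ * x) := by nlinarith
    have : 2 / x ^ 3 + (2 * κ) / x ^ 2 = 2 * (1 + κ * x) / x ^ 3 := by
      rw [div_add_div _ _ (pow_ne_zero 3 hxo.1.ne') (pow_ne_zero 2 hxo.1.ne'),
        div_eq_div_iff (mul_ne_zero (pow_ne_zero 3 hxo.1.ne') (pow_ne_zero 2 hxo.1.ne')) (pow_ne_zero 3 hxo.1.ne')]
      ring
    rw [this, le_div_iff₀ hx3]
    linarith
  have hcont : ∀ c : ℝ, ContinuousOn (fun x : ℝ => 2 / x ^ 3 + c / x ^ 2) (uIcc g₁ g₂) := fun c => by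
    refine ContinuousOn.add ?_ ?_
    · exact continuousOn_const.div (continuousOn_pow 3) fun x hx => pow_ne_zero 3 (hpos x hx).ne'
    · exact continuousOn_const.div (continuousOn_pow 2) fun x hx => pow_ne_zero 2 (hpos x hx).ne'
  have hint' : IntervalIntegrable (fun x : ℝ => -deriv Λ x) volume g₁ g₂ := hint.neg
  have hI1 := intervalIntegral.integral_mono_ae_restrict h12 ((hcont (-2 * κ)).intervalIntegrable) hint' hlo
  have hI2 := intervalIntegral.integral_mono_ae_restrict h12 hint' ((hcont (2 * κ)).intervalIntegrable) hhi
  rw [integral_chart_bounds hg₁.1 h12] at hI1 hI2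
  rw [intervalIntegral.integral_neg, hftc] at hI1 hI2
  rw [abs_le]
  constructor <;> linarith

/-- **THE INTEGRATED ONE-LOOP LAW OF THE CONTINUOUS RG, WITH SQUARE-ROOT DEFECT AND NO ADDITIVE CONSTANT**: for every dynamical Abel function Λ (strictly antitone on
]0, e′] onto `[Λ e′, ∞[`), β₀ > 0, `g ∈ ]0, e′]`, `s ≥ 0`: **`|1∕φ_s(g)² − 1∕g² − sβ₀| ≤ 2κ(1∕φ_s g − 1∕g)`** — part 47's `κg(1∕φ_s(g)² − 1∕g²)` sharpened by
`2∕(g∕φ_s g + 1)`; deep in the ultraviolet the defect is O(1∕φ_s g) = O(√s), the continuous form of part 33's square-root defect, here with explicit constant 2κ and no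
additive term. [cite: Balaban1987RG1, Thm 2 (0.31) p.259 with (0.18)–(0.20) pp.255–256] -/
theorem abs_rg_chart_sub_le_sharp {B : (ℕ → ℝ) → ℝ} {Cm θ γ β₀ bs ta gs e' : ℝ} {t : ℕ → ℝ} {a : ℕ → ℝ} {Λ : ℝ → ℝ}
    (hB : MemoryProfile Cm θ γ B) (hCm : 0 ≤ Cm) (hθ0 : 0 ≤ θ) (hθ1 : θ < 1) (hbs : 0 < bs) (hta : 0 < ta)
    (hts : SeqBox γ t) (htf : MemFlow B gs t) (hprof : ∀ m : ℕ, 1 / ta ^ 2 + bs * (m : ℝ) ≤ 1 / (t m) ^ 2)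
    (hΛ : ∀ e ∈ Ioc (0 : ℝ) e', ∀ h : ℕ → ℝ, SeqBox γ h → MemFlow B e h → Tendsto (fun n => 1 / h n ^ 2 - a n) atTop (𝓝 (Λ e)))
    (hanti : StrictAntiOn Λ (Ioc 0 e')) (honto : ∀ y : ℝ, Λ e' ≤ y → ∃ x ∈ Ioc (0 : ℝ) e', Λ x = y) (hβ₀ : 0 < β₀)
    (h2e' : 2 * e' ≤ γ)
    (hs1 : 4 * Cm * e' ≤ bs * (1 - θ))
    (hs2 : e' ^ 2 * (1 / gs ^ 2 + Cm * γ / (1 - θ) ^ 2 + (2 * Cm / ((1 - θ) * bs)) ^ 2) ≤ 3 / 4)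
    (hs4 : 64 * Cm * e' ^ 3 ≤ (1 - θ) ^ 2) (hs5 : Cm * (8 * e' ^ 3 + 16 * e' / bs) ≤ (1 - θ) / 4)
    {g s : ℝ} (hg : g ∈ Ioc (0 : ℝ) e') (hs : 0 ≤ s) :
    |1 / invFunOn Λ (Ioc 0 e') (Λ g + s * β₀) ^ 2 - 1 / g ^ 2 - s * β₀|
      ≤ 2 * (64 * Cm / (3 * (1 - θ) * bs)) * (1 / invFunOn Λ (Ioc 0 e') (Λ g + s * β₀) - 1 / g) := by
  obtain ⟨hxmem, hΛx⟩ := rg_mem_eq hanti honto hβ₀.le hg hs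
  have hle : invFunOn Λ (Ioc 0 e') (Λ g + s * β₀) ≤ g := rg_le_self hanti honto hβ₀.le hg hs
  have := abs_dynAbel_sub_sub_chart_le_sharp hB hCm hθ0 hθ1 hbs hta hts htf hprof hΛ hanti h2e' hs1 hs2 hs4 hs5 hxmem hg hle
  rw [hΛx] at this
  rw [show 1 / invFunOn Λ (Ioc 0 e') (Λ g + s * β₀) ^ 2 - 1 / g ^ 2 - s * β₀
      = -((Λ g + s * β₀ - Λ g) - (1 / invFunOn Λ (Ioc 0 e') (Λ g + s * β₀) ^ 2 - 1 / g ^ 2)) by ring, abs_neg]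
  exact this

end

end Summit.QuantumFields.BalabanUV.Beta.EriceFlowEnclosureB12AsPrintedHistoryContagionShiftFlowZeroSemigroupGellMannLowIntegral
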